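import Summits.NavierStokesRegularity.NavierStokesRegularity.Theorems.TerminalTraceTypeITraceScarL3SqrtTwoApexAssemblyTools
import Summits.NavierStokesRegularity.NavierStokesRegularity.Theorems.TerminalTraceTypeITraceScarL3SqrtTwoApexCutoffCalculus
import Literature.Analysis.FluidPDE.NSBootstrapContinuousRep
import HarnessLib

/-!
# Slice bounds for the classical representative of an extinct Type-I apex at EVERY late time (ROUND-27
# «THE √2 APEX», T27-A assembly) — item `TerminalTrace.TypeITraceScarL3`, stmt-NavierStokesRegularity-18385

Seat nsreg-C26-p1 g2 (cell ns-regularity-ideate), `--supports stmt-NavierStokesRegularity-18385` (helper).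
The inputs of the classical shell-pressure budget `exists_shellBudget_of_mild` (nsreg-typer g21, plate b2) are
statements at ONE time `t`; the package gives them for a.e. time.  For a representative `V` that is continuous
and jointly smooth below the top they hold at every time:

* `lintegral_ball_repr_sq_le` — the A-Morrey bound at every time: `∫_{B(z,r)} ‖V(t)‖² ≤ 2rM` for all `z` and all
  `t ∈ ]−r², 0[` (the a.e. bound `∫_{B(z,2r)} |U(s)|² ≤ 2rM` of `ae_lintegral_ball_le_of_typeIBound`, the smooth
  cut-off energy `∫ ‖χV(s)‖²` between the two balls is continuous in `s`, so the bound holds everywhere).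
* `norm_repr_le_of_quietShell` — the quiet bound at every point: `‖V(t,y)‖ ≤ K` on the OPEN quiet slab
  (`U ≤ K` a.e. there, `U = V` a.e., `V` continuous: an open set of positive measure cannot carry `‖V‖ > K`).

WHAT THIS IS NOT: not T27-A, not NS regularity — bookkeeping.  [folklore]
-/

noncomputable section

set_option linter.dupNamespace false

namespace Summit.NavierStokesRegularity.NavierStokesRegularity.Theorems.TypeITraceScarL3

open MeasureTheory Set Function Filter Topology Metric InnerProductSpace
open Literature.Analysis Literature.Analysis.FluidPDE
open scoped NNReal ENNReal RealInnerProductSpace ContDiff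

/-- **The A-Morrey bound of the representative at every late time** (module docstring). [folklore] -/
theorem lintegral_ball_repr_sq_le
    {U V : ℝ → EuclideanSpace ℝ (Fin 3) → EuclideanSpace ℝ (Fin 3)}
    {P : ℝ → EuclideanSpace ℝ (Fin 3) → ℝ}
    {G : ℝ → EuclideanSpace ℝ (Fin 3) → EuclideanSpace ℝ (Fin 3) →L[ℝ] EuclideanSpace ℝ (Fin 3)}
    {M : ℝ≥0}
    (hI : ∀ a : ℝ, 0 < a →
      typeIBound (parabolicCylinder a (0 : ℝ × EuclideanSpace ℝ (Fin 3))) U P G ≤ M)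
    (hUV : ∀ᵐ s ∂(volume.restrict (Iio (0 : ℝ))), ∀ᵐ y : EuclideanSpace ℝ (Fin 3), U s y = V s y)
    (hsm : IsSmoothSpaceTimeOn (Iio 0) V) {r : ℝ} (hr : 0 < r) (z : EuclideanSpace ℝ (Fin 3))
    {t : ℝ} (ht : t ∈ Ioo (-r ^ 2) 0) :
    ∫⁻ y in ball z r, ‖V t y‖ₑ ^ 2 ≤ ENNReal.ofReal (2 * r * M) := by
  -- the cut-off between `B(z, r)` and `B(z, 2r)`
  let χ : ContDiffBump z := ⟨r, 2 * r, hr, by linarith⟩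
  have hχ : ContDiff ℝ ∞ (χ : EuclideanSpace ℝ (Fin 3) → ℝ) := χ.contDiff
  have hχc : HasCompactSupport (χ : EuclideanSpace ℝ (Fin 3) → ℝ) := χ.hasCompactSupport
  -- the cut-off energy is continuous on `]−r², 0[`
  have hsm' : IsSmoothSpaceTimeOn (Ioo (-r ^ 2) 0) V := hsm.mono fun s hs => hs.2
  have hEc : ContinuousOn (fun s => ∫ y, ‖(χ : EuclideanSpace ℝ (Fin 3) → ℝ) y • V s y‖ ^ 2) (Ioo (-r ^ 2) 0) :=
    fun s hs => (hasDerivAt_integral_norm_sq_cutoff isOpen_Ioo hsm' hχ hχc hs).continuousAt.continuousWithinAt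
  -- integrability of the cut-off energy density at times `< 0`
  have hEint : ∀ s : ℝ, s < 0 → Integrable (fun y => ‖(χ : EuclideanSpace ℝ (Fin 3) → ℝ) y • V s y‖ ^ 2)
      (volume : Measure (EuclideanSpace ℝ (Fin 3))) := fun s hs =>
    ((hχ.continuous.smul (hsm.contDiff_slice hs).continuous).norm.pow 2).integrable_of_hasCompactSupport
      (HasCompactSupport.intro hχc fun y hy => by simp [image_eq_zero_of_notMem_tsupport hy])
  -- pointwise comparison `‖χV‖ₑ² ≤ 1_{B(z,2r)} ‖V‖ₑ²` and `1_{B(z,r)} ‖V‖ₑ² ≤ ‖χV‖ₑ²`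
  have hup : ∀ s y, ‖(χ : EuclideanSpace ℝ (Fin 3) → ℝ) y • V s y‖ₑ ^ 2 ≤
      (ball z (2 * r)).indicator (fun y => ‖V s y‖ₑ ^ 2) y := by
    intro s y
    by_cases hy : y ∈ ball z (2 * r)
    · rw [indicator_of_mem hy]
      have hn : ‖(χ : EuclideanSpace ℝ (Fin 3) → ℝ) y • V s y‖ ≤ ‖V s y‖ := by
        rw [norm_smul, Real.norm_of_nonneg χ.nonneg]
        exact mul_le_of_le_one_left (norm_nonneg _) χ.le_one
      calc ‖(χ : EuclideanSpace ℝ (Fin 3) → ℝ) y • V s y‖ₑ ^ 2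
          = ENNReal.ofReal (‖(χ : EuclideanSpace ℝ (Fin 3) → ℝ) y • V s y‖ ^ 2) := by
            rw [← ofReal_norm, ENNReal.ofReal_pow (norm_nonneg _)]
        _ ≤ ENNReal.ofReal (‖V s y‖ ^ 2) := ENNReal.ofReal_le_ofReal (pow_le_pow_left₀ (norm_nonneg _) hn 2)
        _ = ‖V s y‖ₑ ^ 2 := by rw [← ofReal_norm, ENNReal.ofReal_pow (norm_nonneg _)]
    · rw [indicator_of_notMem hy]
      rw [mem_ball, not_lt] at hy
      rw [χ.zero_of_le_dist hy, zero_smul]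
      simp
  have hlow : ∀ s, ∀ y ∈ ball z r, ‖V s y‖ₑ ^ 2 = ‖(χ : EuclideanSpace ℝ (Fin 3) → ℝ) y • V s y‖ₑ ^ 2 := by
    intro s y hy
    rw [χ.one_of_mem_closedBall (ball_subset_closedBall hy), one_smul]
  -- the a.e. bound from the A-Morrey part of `𝐈 ≤ M` at radius `2r`, transferred to `V`
  have h2r : 0 < 2 * r := by linarith
  have hae0 := ae_lintegral_ball_le_of_typeIBound hI z h2r
  have hsub : Ioo (-r ^ 2) 0 ⊆ Ioo (-(2 * r) ^ 2) 0 := Ioo_subset_Ioo (by nlinarith) le_rfl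
  have hae : ∀ᵐ s ∂(volume.restrict (Ioo (-r ^ 2) 0)),
      ∫ y, ‖(χ : EuclideanSpace ℝ (Fin 3) → ℝ) y • V s y‖ ^ 2 ≤ 2 * r * M := by
    filter_upwards [ae_restrict_of_ae_restrict_of_subset hsub hae0,
      ae_restrict_of_ae_restrict_of_subset (fun s hs => hs.2) hUV, ae_restrict_mem measurableSet_Ioo]
      with s hs1 hs2 hs
    have hle : ENNReal.ofReal (∫ y, ‖(χ : EuclideanSpace ℝ (Fin 3) → ℝ) y • V s y‖ ^ 2) ≤
        ENNReal.ofReal (2 * r * M) := by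
      rw [ofReal_integral_eq_lintegral_ofReal (hEint s hs.2) (Eventually.of_forall fun y => sq_nonneg _)]
      calc ∫⁻ y, ENNReal.ofReal (‖(χ : EuclideanSpace ℝ (Fin 3) → ℝ) y • V s y‖ ^ 2)
          = ∫⁻ y, ‖(χ : EuclideanSpace ℝ (Fin 3) → ℝ) y • V s y‖ₑ ^ 2 :=
            lintegral_congr fun y => by rw [← ofReal_norm, ENNReal.ofReal_pow (norm_nonneg _)]
        _ ≤ ∫⁻ y, (ball z (2 * r)).indicator (fun y => ‖V s y‖ₑ ^ 2) y := lintegral_mono (hup s)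
        _ = ∫⁻ y in ball z (2 * r), ‖V s y‖ₑ ^ 2 := lintegral_indicator measurableSet_ball _
        _ = ∫⁻ y in ball z (2 * r), ‖U s y‖ₑ ^ 2 := by
            refine lintegral_congr_ae ?_
            filter_upwards [ae_restrict_of_ae hs2] with y hy
            rw [hy]
        _ ≤ (M : ℝ≥0∞) * ENNReal.ofReal (2 * r) := hs1
        _ = ENNReal.ofReal (2 * r * M) := by
            rw [ENNReal.ofReal_mul (by positivity : (0 : ℝ) ≤ 2 * r), ENNReal.ofReal_coe_nnreal, mul_comm]
    exact (ENNReal.ofReal_le_ofReal_iff (by positivity)).1 hle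
  have hall := le_of_ae_le_of_continuousOn_Ioo hEc hae t ht
  -- conclude at the time `t`
  calc ∫⁻ y in ball z r, ‖V t y‖ₑ ^ 2
      = ∫⁻ y in ball z r, ‖(χ : EuclideanSpace ℝ (Fin 3) → ℝ) y • V t y‖ₑ ^ 2 :=
        setLIntegral_congr_fun measurableSet_ball (hlow t)
    _ ≤ ∫⁻ y, ‖(χ : EuclideanSpace ℝ (Fin 3) → ℝ) y • V t y‖ₑ ^ 2 := setLIntegral_le_lintegral _ _
    _ = ENNReal.ofReal (∫ y, ‖(χ : EuclideanSpace ℝ (Fin 3) → ℝ) y • V t y‖ ^ 2) := by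
        rw [ofReal_integral_eq_lintegral_ofReal (hEint t ht.2) (Eventually.of_forall fun y => sq_nonneg _)]
        exact lintegral_congr fun y => by rw [← ofReal_norm, ENNReal.ofReal_pow (norm_nonneg _)]
    _ ≤ ENNReal.ofReal (2 * r * M) := ENNReal.ofReal_le_ofReal hall

/-- **The quiet bound holds at every point of the open quiet slab for the continuous representative**
(module docstring). [folklore] -/
theorem norm_repr_le_of_quietShell
    {U V : ℝ → EuclideanSpace ℝ (Fin 3) → EuclideanSpace ℝ (Fin 3)} {δ R A K : ℝ}
    (hq : ∀ᵐ z ∂(volume.restrict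
      (Ioo (-δ) 0 ×ˢ {y : EuclideanSpace ℝ (Fin 3) | R < ‖y‖ ∧ ‖y‖ < A * R})), ‖U z.1 z.2‖ ≤ K)
    (hUV : ∀ᵐ w ∂(volume.restrict (Iio (0 : ℝ) ×ˢ (univ : Set (EuclideanSpace ℝ (Fin 3))))),
      uncurry U w = uncurry V w)
    (hVc : ContinuousOn (uncurry V) (Iio (0 : ℝ) ×ˢ (univ : Set (EuclideanSpace ℝ (Fin 3))))) :
    ∀ t ∈ Ioo (-δ) 0, ∀ y : EuclideanSpace ℝ (Fin 3), R < ‖y‖ → ‖y‖ < A * R → ‖V t y‖ ≤ K := by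
  set Ω : Set (ℝ × EuclideanSpace ℝ (Fin 3)) :=
    Ioo (-δ) 0 ×ˢ {y : EuclideanSpace ℝ (Fin 3) | R < ‖y‖ ∧ ‖y‖ < A * R} with hΩ
  have hΩo : IsOpen Ω := isOpen_Ioo.prod
    ((isOpen_lt continuous_const continuous_norm).inter (isOpen_lt continuous_norm continuous_const))
  have hΩslab : Ω ⊆ Iio (0 : ℝ) ×ˢ univ := prod_mono (fun t ht => ht.2) (subset_univ _)
  have hVK : ∀ᵐ z ∂(volume.restrict Ω), ‖V z.1 z.2‖ ≤ K := by
    filter_upwards [hq, ae_restrict_of_ae_restrict_of_subset hΩslab hUV] with z hz hz2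
    have e : U z.1 z.2 = V z.1 z.2 := hz2
    rw [← e]; exact hz
  have hc : ContinuousOn (fun z : ℝ × EuclideanSpace ℝ (Fin 3) => ‖V z.1 z.2‖) Ω := (hVc.mono hΩslab).norm
  intro t ht y hy1 hy2
  have hzΩ : (t, y) ∈ Ω := ⟨ht, hy1, hy2⟩
  by_contra hlt
  rw [not_le] at hlt
  set N : Set (ℝ × EuclideanSpace ℝ (Fin 3)) := Ω ∩ (fun z => ‖V z.1 z.2‖) ⁻¹' Ioi K with hN
  have hNopen : IsOpen N := hc.isOpen_inter_preimage hΩo isOpen_Ioi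
  have hNpos : 0 < volume N := hNopen.measure_pos volume ⟨(t, y), hzΩ, hlt⟩
  have hNzero : volume N = 0 := by
    have h1 : ∀ᵐ z ∂(volume : Measure (ℝ × EuclideanSpace ℝ (Fin 3))), z ∈ Ω → ‖V z.1 z.2‖ ≤ K :=
      (ae_restrict_iff' hΩo.measurableSet).1 hVK
    refine measure_mono_null (fun z hzN => ?_) (ae_iff.1 h1)
    intro hz
    have h2 : K < ‖V z.1 z.2‖ := hzN.2
    exact absurd (hz hzN.1) (not_le.2 h2)
  exact absurd hNzero hNpos.ne'

end Summit.NavierStokesRegularity.NavierStokesRegularity.Theorems.TypeITraceScarL3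

end
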